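import Literature.Analysis.FluidPDE.CubeShellDivergence
import Literature.Analysis.FluidPDE.NewtonLocalPotentialCalculus
import Literature.Analysis.FluidPDE.HessianLaplacianLpProofs
import Literature.Analysis.FluidPDE.WholeSpaceIBP
import HarnessLib

/-!
# The ring corrector: a compactly supported right inverse of `div` on cubical shells with
# scale-invariant `L^p` gradient bounds

Analysis/FluidPDE support file (everything proved; no named facts) on the discharge path of the
named fact `Literature.Analysis.FluidPDE.SereginWang2020_annular_liouville`
(`SteadyLiouvilleCriteria.lean`; Seregin–Wang 2020, Thm 1.1 (i)). In the printed proof of the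
Caccioppoli inequality (ibid., Prop. 2.1) the cut-off `φu` of the divergence-free velocity is
corrected by Bogovskiĭ's solution of `div w = ∇φ·u` on the annulus `B(r) ∖ B(2r/3)` with
`‖∇w‖_{L^s} ≤ C(s) ‖∇φ·u‖_{L^s}` ("by Theorem III 3.4 in [Galdi] and by scaling"). Neither Mathlib
nor the tree has Bogovskiĭ's operator; this file builds a substitute from tree material:

  `w = ∇N[f] + W[Λ f]`,

where `N = N_{δ/2,δ}` is the truncated Newtonian potential of the tree (`NewtonLocalPotential`:
`ΔN[f] = f − Λ[f]`, `Λ[f] = λ ⋆ f` a smooth remainder of scale `δ`, and — by the tree's PROVED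
Calderón–Zygmund theory, `stein1970_hessian_Lp_bound_holds_fin3` — `‖D²N[f]‖_p ≤ C_p ‖f‖_p`
uniformly in `δ`), and `W` is the explicit lossy solver of `CubeShellDivergence`
(`div W[g] = g`, `‖DW[g]‖_∞ ≲ sup|g| + b sup‖Dg‖`), applied to the smooth mean-zero remainder
`g = Λ f`, whose `sup` norms are controlled by `δ⁻³‖f‖₁`, `δ⁻⁴‖f‖₁`.

## Main results

* `RingCorrector.ringCorrector a b δ f` and `RingCorrector.Geometry a b δ f` (the hypotheses:
  `0 < a`, `0 < δ`, `a + δ < b − δ`, `b ≤ 2a`, `f ∈ C^∞`, `f = 0` off the cubical shell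
  `S(a + δ, b − δ)`, `∫ f = 0`);
* `Geometry.contDiff_ringCorrector`, `Geometry.tsupport_ringCorrector_subset` (`⊆ S(a, b)`),
  `Geometry.divergence_ringCorrector` (`div w = f`);
* `RingCorrector.exists_eLpNorm_fderiv_ringCorrector_le`: for `1 < p < ∞` a constant `K(p)` with
  `‖Dw‖_{L^p} ≤ K (b/(b−a))⁵ (b/δ)⁴ ‖f‖_{L^p}` — the first-order, scale-invariant estimate (up to
  powers of the aspect ratios) which replaces Bogovskiĭ's.

## References

* G. Seregin, W. Wang, St. Petersburg Math. J. 31 (2020) 387–393 = arXiv:1805.02227, proof of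
  Prop. 2.1. [SereginWang2020]
* G. P. Galdi, *An Introduction to the Mathematical Theory of the Navier–Stokes Equations*,
  2nd ed. (2011), §III.3 (Bogovskiĭ's operator; not used).
* E. M. Stein, *Singular integrals and differentiability properties of functions* (1970),
  Ch. III §1.3, Prop. 3 (the Hessian bound, proved in the tree). [Stein1971]
-/

noncomputable section

open MeasureTheory Set Filter Topology Function Metric intervalIntegral
open scoped RealInnerProductSpace ContDiff NNReal ENNReal

namespace Literature.Analysis.FluidPDE

namespace RingCorrector

open CubeShell
open scoped Pointwise

/-- `2 ≤ ∞` in `WithTop ℕ∞` (bookkeeping). [folklore] -/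
theorem two_le_infty : (2 : WithTop ℕ∞) ≤ ((⊤ : ℕ∞) : WithTop ℕ∞) := by
  change ((2 : ℕ∞) : WithTop ℕ∞) ≤ ((⊤ : ℕ∞) : WithTop ℕ∞)
  exact WithTop.coe_le_coe.2 le_top

/-- Local notation for physical space `ℝ³ = EuclideanSpace ℝ (Fin 3)`. -/
local notation "ℝ³" => EuclideanSpace ℝ (Fin 3)

/-! ### The derivative bound for `W`, repackaged -/

/-- The absolute constant of the lossy solver. [folklore] -/
def KW : ℝ := 179402 * B ^ 5

/-- Auxiliary (theorem `KW_pos`): KW pos. [folklore] -/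
theorem KW_pos : 0 < KW := by rw [KW]; have := B_pos; positivity

/-- **`‖DW‖ ≤ K_W (b/(b-a))⁵ (G₀ + bG₁)` everywhere.** [folklore] -/
theorem norm_fderiv_W_le {a b G₀ G₁ : ℝ} {g : ℝ³ → ℝ} (dd : Datum a b g) (bd : BData a b g G₀ G₁)
    (x : ℝ³) : ‖fderiv ℝ (W a b g) x‖ ≤ KW * (b / (b - a)) ^ 5 * (G₀ + b * G₁) := by
  have hΛ : Λ a b ^ 5 = B ^ 5 * (b / (b - a)) ^ 5 := by rw [Λ, ← mul_pow, mul_div_assoc]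
  by_cases hx : x ∈ cube b
  · refine (bd.norm_fderiv_W_le_of_mem hx).trans (le_of_eq ?_)
    rw [hΛ, KW]; ring
  · have hx' : x ∉ tsupport (W a b g) := fun h => hx (shell_subset_cube a b (dd.tsupport_W_subset h))
    rw [fderiv_of_notMem_tsupport ℝ hx', norm_zero, KW]
    have := bd.E_nonneg
    have : 0 ≤ b / (b - a) := div_nonneg bd.hb.le bd.hℓ.le
    have := B_pos
    positivity

/-! ### Geometry: thickening a shell -/

/-- `S(a + δ, b - δ) + B̄(0, δ) ⊆ S(a, b)`. [folklore] -/
theorem shell_add_closedBall_subset {a b δ : ℝ} :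
    shell (a + δ) (b - δ) + closedBall (0 : ℝ³) δ ⊆ shell a b := by
  rintro _ ⟨x, hx, z, hz, rfl⟩
  rw [mem_closedBall_zero_iff] at hz
  have hzi : ∀ i, |z i| ≤ δ := fun i => (abs_coord_le_norm z i).trans hz
  refine ⟨?_, fun i => ?_⟩
  · obtain ⟨i, hi⟩ := hx.1
    refine ⟨i, ?_⟩
    have h1 : |x i| ≤ |x i + z i| + |z i| := by
      have := abs_add_le (x i + z i) (-(z i))
      rwa [add_neg_cancel_right, abs_neg] at this
    have h2 := hzi i
    simp only [PiLp.add_apply]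
    linarith
  · simp only [PiLp.add_apply]
    exact (abs_add_le _ _).trans (by linarith [hx.2 i, hzi i])

/-- A function vanishing off a closed set has `tsupport` inside it. [folklore] -/
theorem tsupport_subset_of_vanish {s : Set ℝ³} (hs : IsClosed s) {f : ℝ³ → ℝ}
    (hf : ∀ x, x ∉ s → f x = 0) : tsupport f ⊆ s :=
  closure_minimal (fun x hx => by by_contra h; exact hx (hf x h)) hs

variable {a b δ : ℝ} {f : ℝ³ → ℝ}

/-- `supp N[f] ⊆ tsupport f + B̄(0, δ)` for the potential at radii `(δ/2, δ)`. [folklore] -/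
theorem newtonNearPotential_eq_zero_of_notMem (hδ : 0 < δ) {x : ℝ³}
    (hx : x ∉ tsupport f + closedBall (0 : ℝ³) δ) : newtonNearPotential (δ / 2) δ f x = 0 := by
  refine newtonNearPotential_eq_zero_of_forall (by positivity) (by linarith) fun z hz => ?_
  by_contra hne
  exact hx ⟨x - z, subset_tsupport _ (mem_support.2 hne), z, mem_closedBall_zero_iff.2 hz,
    sub_add_cancel x z⟩

/-- `supp Λ[f] ⊆ tsupport f + B̄(0, δ)`. [folklore] -/
theorem newtonFarSmoothing_eq_zero_of_notMem (hδ : 0 < δ) {x : ℝ³}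
    (hx : x ∉ tsupport f + closedBall (0 : ℝ³) δ) : newtonFarSmoothing (δ / 2) δ f x = 0 := by
  refine newtonFarSmoothing_eq_zero_of_forall (by positivity) (by linarith) fun z hz => ?_
  by_contra hne
  exact hx ⟨x - z, subset_tsupport _ (mem_support.2 hne), z, mem_closedBall_zero_iff.2 hz,
    sub_add_cancel x z⟩

/-- Auxiliary (theorem `isClosed_tsupport_add_closedBall`): isClosed tsupport add closedBall. [folklore] -/
theorem isClosed_tsupport_add_closedBall (hf : HasCompactSupport f) :
    IsClosed (tsupport f + closedBall (0 : ℝ³) δ) :=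
  (hf.isCompact.add (isCompact_closedBall _ _)).isClosed

/-- `tsupport N[f] ⊆ S(a, b)` when `f` vanishes off `S(a + δ, b - δ)`. [folklore] -/
theorem tsupport_newtonNearPotential_subset (hδ : 0 < δ)
    (hf0 : ∀ x, x ∉ shell (a + δ) (b - δ) → f x = 0) :
    tsupport (newtonNearPotential (δ / 2) δ f) ⊆ shell a b := by
  have hfs : tsupport f ⊆ shell (a + δ) (b - δ) := tsupport_subset_of_vanish (isClosed_shell _ _) hf0
  have hfc : HasCompactSupport f := (isCompact_shell _ _).of_isClosed_subset isClosed_closure hfs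
  refine (tsupport_subset_of_vanish (isClosed_tsupport_add_closedBall hfc)
    (fun x hx => newtonNearPotential_eq_zero_of_notMem hδ hx)).trans ?_
  exact (Set.add_subset_add_right hfs).trans shell_add_closedBall_subset

/-- `tsupport Λ[f] ⊆ S(a, b)` when `f` vanishes off `S(a + δ, b - δ)`. [folklore] -/
theorem tsupport_newtonFarSmoothing_subset (hδ : 0 < δ)
    (hf0 : ∀ x, x ∉ shell (a + δ) (b - δ) → f x = 0) :
    tsupport (newtonFarSmoothing (δ / 2) δ f) ⊆ shell a b := by
  have hfs : tsupport f ⊆ shell (a + δ) (b - δ) := tsupport_subset_of_vanish (isClosed_shell _ _) hf0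
  have hfc : HasCompactSupport f := (isCompact_shell _ _).of_isClosed_subset isClosed_closure hfs
  refine (tsupport_subset_of_vanish (isClosed_tsupport_add_closedBall hfc)
    (fun x hx => newtonFarSmoothing_eq_zero_of_notMem hδ hx)).trans ?_
  exact (Set.add_subset_add_right hfs).trans shell_add_closedBall_subset

/-- Auxiliary (theorem `hasCompactSupport_of_vanish_shell`): hasCompactSupport of vanish shell. [folklore] -/
theorem hasCompactSupport_of_vanish_shell {a' b' : ℝ} (hf0 : ∀ x, x ∉ shell a' b' → f x = 0) :
    HasCompactSupport f :=
  (isCompact_shell _ _).of_isClosed_subset isClosed_closure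
    (tsupport_subset_of_vanish (isClosed_shell _ _) hf0)

/-! ### The remainder `g₁ = Λ[f]`: smoothness, mass zero, `sup` bounds -/

/-- `sup |λ_{1/2,1}|` and `sup ‖Dλ_{1/2,1}‖` packaged in one absolute constant `M_λ ≥ 1`. [folklore] -/
theorem exists_newtonFarLaplacian_bounds : ∃ M : ℝ, 1 ≤ M ∧
    (∀ z, |newtonFarLaplacian (1 / 2) 1 z| ≤ M) ∧ ∀ z, ‖fderiv ℝ (newtonFarLaplacian (1 / 2) 1) z‖ ≤ M := by
  have h₀ : (0 : ℝ) < 1 / 2 := by norm_num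
  have h₁ : (1 : ℝ) / 2 < 1 := by norm_num
  have hc : ContDiff ℝ 1 (newtonFarLaplacian (1 / 2) 1) := contDiff_newtonFarLaplacian h₀ h₁
  have hcs : HasCompactSupport (newtonFarLaplacian (1 / 2) 1) := hasCompactSupport_newtonFarLaplacian h₀.le h₁
  obtain ⟨B₀, hB₀⟩ := (hc.continuous.norm).bddAbove_range_of_hasCompactSupport hcs.norm
  obtain ⟨B₁, hB₁⟩ := ((hc.continuous_fderiv (by simp)).norm).bddAbove_range_of_hasCompactSupport
    (hcs.fderiv (𝕜 := ℝ)).norm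
  refine ⟨max 1 (max B₀ B₁), le_max_left _ _, fun z => ?_, fun z => ?_⟩
  · have h : ‖newtonFarLaplacian (1 / 2) 1 z‖ ≤ B₀ := hB₀ ⟨z, rfl⟩
    rw [Real.norm_eq_abs] at h
    exact h.trans ((le_max_left _ _).trans (le_max_right _ _))
  · have h : ‖fderiv ℝ (newtonFarLaplacian (1 / 2) 1) z‖ ≤ B₁ := hB₁ ⟨z, rfl⟩
    exact h.trans ((le_max_right _ _).trans (le_max_right _ _))

/-- The absolute constant `M_λ`. [folklore] -/
def Mker : ℝ := Classical.choose exists_newtonFarLaplacian_bounds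

/-- Auxiliary (theorem `one_le_Mker`): one le Mker. [folklore] -/
theorem one_le_Mker : 1 ≤ Mker := (Classical.choose_spec exists_newtonFarLaplacian_bounds).1

/-- Auxiliary (theorem `Mker_pos`): Mker pos. [folklore] -/
theorem Mker_pos : 0 < Mker := one_pos.trans_le one_le_Mker

/-- Auxiliary (theorem `abs_newtonFarLaplacian_one_le`): abs newtonFarLaplacian one le. [folklore] -/
theorem abs_newtonFarLaplacian_one_le (z : ℝ³) : |newtonFarLaplacian (1 / 2) 1 z| ≤ Mker :=
  (Classical.choose_spec exists_newtonFarLaplacian_bounds).2.1 z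

/-- Auxiliary (theorem `norm_fderiv_newtonFarLaplacian_one_le`): norm fderiv newtonFarLaplacian one le. [folklore] -/
theorem norm_fderiv_newtonFarLaplacian_one_le (z : ℝ³) :
    ‖fderiv ℝ (newtonFarLaplacian (1 / 2) 1) z‖ ≤ Mker :=
  (Classical.choose_spec exists_newtonFarLaplacian_bounds).2.2 z

/-- Scaling: `λ_{δ/2,δ}(z) = δ⁻³ λ_{1/2,1}(δ⁻¹ z)`. [folklore] -/
theorem newtonFarLaplacian_delta (hδ : 0 < δ) (z : ℝ³) :
    newtonFarLaplacian (δ / 2) δ z = δ⁻¹ ^ 3 * newtonFarLaplacian (1 / 2) 1 (δ⁻¹ • z) := by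
  have := newtonFarLaplacian_scale hδ (1 / 2) 1 z
  rw [mul_one, show δ * (1 / 2) = δ / 2 by ring] at this
  exact this

/-- Auxiliary (theorem `newtonFarLaplacian_delta'`): newtonFarLaplacian delta'. [folklore] -/
theorem newtonFarLaplacian_delta' (hδ : 0 < δ) :
    newtonFarLaplacian (δ / 2) δ = fun z => δ⁻¹ ^ 3 * newtonFarLaplacian (1 / 2) 1 (δ⁻¹ • z) :=
  funext (newtonFarLaplacian_delta hδ)

/-- `|λ_{δ/2,δ}| ≤ M_λ δ⁻³`. [folklore] -/
theorem abs_newtonFarLaplacian_delta_le (hδ : 0 < δ) (z : ℝ³) :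
    |newtonFarLaplacian (δ / 2) δ z| ≤ Mker / δ ^ 3 := by
  have h3 : (0 : ℝ) < δ⁻¹ ^ 3 := by positivity
  have h := newtonFarLaplacian_delta hδ z
  calc |newtonFarLaplacian (δ / 2) δ z| = δ⁻¹ ^ 3 * |newtonFarLaplacian (1 / 2) 1 (δ⁻¹ • z)| := by
        rw [h, abs_mul, abs_of_pos h3]
    _ ≤ δ⁻¹ ^ 3 * Mker := by gcongr; exact abs_newtonFarLaplacian_one_le _
    _ = Mker / δ ^ 3 := by rw [inv_pow, div_eq_inv_mul]

/-- `‖Dλ_{δ/2,δ}‖ ≤ M_λ δ⁻⁴`. [folklore] -/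
theorem norm_fderiv_newtonFarLaplacian_delta_le (hδ : 0 < δ) (z : ℝ³) :
    ‖fderiv ℝ (newtonFarLaplacian (δ / 2) δ) z‖ ≤ Mker / δ ^ 4 := by
  rw [newtonFarLaplacian_delta' hδ]
  have hd : DifferentiableAt ℝ (fun w : ℝ³ => newtonFarLaplacian (1 / 2) 1 (δ⁻¹ • w)) z :=
    ((contDiff_newtonFarLaplacian (by norm_num) (by norm_num) (n := 1)).comp
      (contDiff_id.const_smul δ⁻¹)).differentiable (by simp) z
  have h3 : (0 : ℝ) < δ⁻¹ ^ 3 := by positivity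
  have h1 : (0 : ℝ) < δ⁻¹ := by positivity
  rw [fderiv_const_mul hd, fderiv_comp_smul δ⁻¹, norm_smul, norm_smul, Real.norm_eq_abs,
    Real.norm_eq_abs, abs_of_pos h3, abs_of_pos h1]
  calc δ⁻¹ ^ 3 * (δ⁻¹ * ‖fderiv ℝ (newtonFarLaplacian (1 / 2) 1) (δ⁻¹ • z)‖)
      ≤ δ⁻¹ ^ 3 * (δ⁻¹ * Mker) := by gcongr; exact norm_fderiv_newtonFarLaplacian_one_le _
    _ = Mker / δ ^ 4 := by field_simp

/-- `Λ[f]` is smooth for smooth `f`. [folklore] -/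
theorem contDiff_newtonFarSmoothing_top (hδ : 0 < δ) (hf : ContDiff ℝ ∞ f) :
    ContDiff ℝ ∞ (newtonFarSmoothing (δ / 2) δ f) :=
  contDiff_infty.2 fun n => contDiff_newtonFarSmoothing (by positivity) (by linarith) n
    (contDiff_infty.1 hf n)

/-- **`∫ Λ[f] = 0` when `∫ f = 0`** (`∫ (λ ⋆ f) = (∫ λ)(∫ f)`). [folklore] -/
theorem integral_newtonFarSmoothing_eq_zero (hδ : 0 < δ) (hf : Continuous f)
    (hfc : HasCompactSupport f) (hint : ∫ x, f x = 0) :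
    ∫ x, newtonFarSmoothing (δ / 2) δ f x = 0 := by
  rw [newtonFarSmoothing_eq_convolution,
    integral_convolution (L := ContinuousLinearMap.lsmul ℝ ℝ)
      (integrable_newtonFarLaplacian (by positivity) (by linarith))
      (hf.integrable_of_hasCompactSupport hfc), hint]
  simp

/-- **`|Λ[f](x)| ≤ M_λ δ⁻³ ‖f‖₁`.** [folklore] -/
theorem abs_newtonFarSmoothing_le (hδ : 0 < δ) (hf : Continuous f) (hfc : HasCompactSupport f)
    (x : ℝ³) : |newtonFarSmoothing (δ / 2) δ f x| ≤ Mker / δ ^ 3 * ∫ y, |f y| := by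
  rw [newtonFarSmoothing_eq_integral_kernel]
  have hfi : Integrable (fun y => |f y|) := (hf.integrable_of_hasCompactSupport hfc).abs
  calc |∫ y, f y * newtonFarLaplacian (δ / 2) δ (x - y)|
      ≤ ∫ y, |f y * newtonFarLaplacian (δ / 2) δ (x - y)| := abs_integral_le_integral_abs
    _ ≤ ∫ y, Mker / δ ^ 3 * |f y| := by
        refine integral_mono_of_nonneg (Eventually.of_forall fun y => abs_nonneg _)
          (hfi.const_mul _) (Eventually.of_forall fun y => ?_)
        dsimp only
        rw [abs_mul, mul_comm]
        exact mul_le_mul_of_nonneg_right (abs_newtonFarLaplacian_delta_le hδ _) (abs_nonneg _)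
    _ = Mker / δ ^ 3 * ∫ y, |f y| := MeasureTheory.integral_const_mul _ _

/-- **`|∂ₐΛ[f](x)| ≤ M_λ δ⁻⁴ ‖a‖ ‖f‖₁`.** [folklore] -/
theorem abs_fderiv_newtonFarSmoothing_apply_le (hδ : 0 < δ) (hf : ContDiff ℝ 1 f)
    (hfc : HasCompactSupport f) (x v : ℝ³) :
    |fderiv ℝ (newtonFarSmoothing (δ / 2) δ f) x v| ≤ Mker / δ ^ 4 * ‖v‖ * ∫ y, |f y| := by
  rw [fderiv_newtonFarSmoothing_apply_eq_integral (by positivity) (by linarith) hf x v]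
  have hfi : Integrable (fun z => |f (x - z)|) := by
    have h1 : Integrable (fun y => |f y|) (volume : Measure ℝ³) :=
      (hf.continuous.integrable_of_hasCompactSupport hfc).abs
    exact h1.comp_sub_left x
  have hshift : ∫ z, |f (x - z)| = ∫ y, |f y| := integral_sub_left_eq_self (fun y => |f y|) volume x
  calc |∫ z, fderiv ℝ (newtonFarLaplacian (δ / 2) δ) z v * f (x - z)|
      ≤ ∫ z, |fderiv ℝ (newtonFarLaplacian (δ / 2) δ) z v * f (x - z)| := abs_integral_le_integral_abs
    _ ≤ ∫ z, Mker / δ ^ 4 * ‖v‖ * |f (x - z)| := by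
        refine integral_mono_of_nonneg (Eventually.of_forall fun y => abs_nonneg _)
          (hfi.const_mul _) (Eventually.of_forall fun z => ?_)
        dsimp only
        rw [abs_mul]
        refine mul_le_mul_of_nonneg_right ?_ (abs_nonneg _)
        refine (abs_fderiv_newtonFarLaplacian_apply_le _ _ z v).trans ?_
        exact mul_le_mul_of_nonneg_right (norm_fderiv_newtonFarLaplacian_delta_le hδ z) (norm_nonneg _)
    _ = Mker / δ ^ 4 * ‖v‖ * ∫ y, |f y| := by rw [MeasureTheory.integral_const_mul, hshift]

/-- **`‖DΛ[f](x)‖ ≤ 3 M_λ δ⁻⁴ ‖f‖₁`.** [folklore] -/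
theorem norm_fderiv_newtonFarSmoothing_le (hδ : 0 < δ) (hf : ContDiff ℝ 1 f)
    (hfc : HasCompactSupport f) (x : ℝ³) :
    ‖fderiv ℝ (newtonFarSmoothing (δ / 2) δ f) x‖ ≤ 3 * (Mker / δ ^ 4 * ∫ y, |f y|) := by
  refine (norm_fderiv_le_sum _ x).trans ?_
  calc ∑ j, |fderiv ℝ (newtonFarSmoothing (δ / 2) δ f) x (e j)|
      ≤ ∑ _j : Fin 3, Mker / δ ^ 4 * ∫ y, |f y| := Finset.sum_le_sum fun j _ => by
        have := abs_fderiv_newtonFarSmoothing_apply_le hδ hf hfc x (e j)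
        rwa [norm_e, mul_one] at this
    _ = 3 * (Mker / δ ^ 4 * ∫ y, |f y|) := by simp

/-! ### The gradient field `w₀ = ∇N[f]` -/

/-- `w₀ = Σᵢ ∂ᵢN[f] eᵢ`, the gradient of the truncated Newtonian potential at radii `(δ/2, δ)`.
[folklore] -/
def gradPotential (δ : ℝ) (f : ℝ³ → ℝ) (x : ℝ³) : ℝ³ :=
  ∑ i, fderiv ℝ (newtonNearPotential (δ / 2) δ f) x (e i) • e i

/-- Auxiliary (theorem `contDiff_newtonNearPotential_top'`): contDiff newtonNearPotential top'. [folklore] -/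
theorem contDiff_newtonNearPotential_top' (hδ : 0 < δ) (hf : ContDiff ℝ ∞ f) :
    ContDiff ℝ ∞ (newtonNearPotential (δ / 2) δ f) :=
  contDiff_newtonNearPotential_top (by positivity) (by linarith) hf

/-- Auxiliary (theorem `contDiff_fderiv_apply_e`): contDiff fderiv apply e. [folklore] -/
theorem contDiff_fderiv_apply_e (hδ : 0 < δ) (hf : ContDiff ℝ ∞ f) (i : Fin 3) :
    ContDiff ℝ ∞ (fun x => fderiv ℝ (newtonNearPotential (δ / 2) δ f) x (e i)) :=
  ((contDiff_newtonNearPotential_top' hδ hf).fderiv_right (m := ∞) (by simp)).clm_apply contDiff_const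

/-- `w₀` is smooth. [folklore] -/
theorem contDiff_gradPotential (hδ : 0 < δ) (hf : ContDiff ℝ ∞ f) : ContDiff ℝ ∞ (gradPotential δ f) := by
  unfold gradPotential
  exact ContDiff.sum fun i _ => (contDiff_fderiv_apply_e hδ hf i).smul contDiff_const

/-- Auxiliary (theorem `gradPotential_eq`): gradPotential eq. [folklore] -/
theorem gradPotential_eq (δ : ℝ) (f : ℝ³ → ℝ) : gradPotential δ f = fun x =>
    fderiv ℝ (newtonNearPotential (δ / 2) δ f) x (e 0) • e 0 +
    fderiv ℝ (newtonNearPotential (δ / 2) δ f) x (e 1) • e 1 +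
    fderiv ℝ (newtonNearPotential (δ / 2) δ f) x (e 2) • e 2 := by
  funext x; rw [gradPotential, Fin.sum_univ_three]

/-- **`div w₀ = ΔN[f] = f − Λ[f]`.** [folklore] -/
theorem divergence_gradPotential (hδ : 0 < δ) (hf : ContDiff ℝ ∞ f) (x : ℝ³) :
    VectorCalculus.divergence (gradPotential δ f) x = f x - newtonFarSmoothing (δ / 2) δ f x := by
  have hN2 : ContDiff ℝ 2 (newtonNearPotential (δ / 2) δ f) :=
    (contDiff_newtonNearPotential_top' hδ hf).of_le two_le_infty
  rw [gradPotential_eq, divergence_components (dAt (contDiff_fderiv_apply_e hδ hf 0) x)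
    (dAt (contDiff_fderiv_apply_e hδ hf 1) x) (dAt (contDiff_fderiv_apply_e hδ hf 2) x),
    ← laplacian_newtonNearPotential (by positivity) (by linarith) (hf.of_le two_le_infty) x,
    laplacian_eq_sum_fderiv_fderiv (EuclideanSpace.basisFun (Fin 3) ℝ) hN2, Fin.sum_univ_three,
    basisFun_eq_e, basisFun_eq_e, basisFun_eq_e]

/-- `w₀` vanishes off `tsupport N[f]`. [folklore] -/
theorem gradPotential_eq_zero {x : ℝ³} (hx : x ∉ tsupport (newtonNearPotential (δ / 2) δ f)) :
    gradPotential δ f x = 0 := by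
  simp [gradPotential, fderiv_of_notMem_tsupport ℝ hx]

/-- `tsupport w₀ ⊆ S(a, b)`. [folklore] -/
theorem tsupport_gradPotential_subset (hδ : 0 < δ) (hf0 : ∀ x, x ∉ shell (a + δ) (b - δ) → f x = 0) :
    tsupport (gradPotential δ f) ⊆ shell a b :=
  (closure_minimal (fun x hx => by by_contra h; exact hx (gradPotential_eq_zero h))
    (isClosed_tsupport _)).trans (tsupport_newtonNearPotential_subset hδ hf0)

/-- Pointwise: `‖Dw₀(x)‖ ≤ Σᵢⱼ |∂ⱼ∂ᵢN[f](x)|`. [folklore] -/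
theorem norm_fderiv_gradPotential_le (hδ : 0 < δ) (hf : ContDiff ℝ ∞ f) (x : ℝ³) :
    ‖fderiv ℝ (gradPotential δ f) x‖ ≤
      ∑ i, ∑ j, |fderiv ℝ (fun y => fderiv ℝ (newtonNearPotential (δ / 2) δ f) y (e i)) x (e j)| := by
  set N := newtonNearPotential (δ / 2) δ f with hN
  have hd : ∀ i, DifferentiableAt ℝ (fun y => fderiv ℝ N y (e i)) x := fun i =>
    dAt (contDiff_fderiv_apply_e hδ hf i) x
  have hW : HasFDerivAt (fun y => ∑ i, fderiv ℝ N y (e i) • e i)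
      (∑ i, (fderiv ℝ (fun y => fderiv ℝ N y (e i)) x).smulRight (e i)) x :=
    HasFDerivAt.fun_sum (u := Finset.univ) (A := fun i y => fderiv ℝ N y (e i) • e i)
      (A' := fun i => (fderiv ℝ (fun y => fderiv ℝ N y (e i)) x).smulRight (e i))
      (x := x) fun i _ => (hd i).hasFDerivAt.smul_const (e i)
  rw [show gradPotential δ f = fun y => ∑ i, fderiv ℝ N y (e i) • e i from rfl, hW.fderiv]
  refine (norm_sum_le _ _).trans (Finset.sum_le_sum fun i _ => ?_)
  rw [ContinuousLinearMap.norm_smulRight_apply, norm_e, mul_one]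
  exact norm_fderiv_le_sum _ x

/-- Differentiability at a point of a `C^∞` map (vector-valued bookkeeping). [folklore] -/
theorem dAt' {F : Type*} [NormedAddCommGroup F] [NormedSpace ℝ F] {u : ℝ³ → F}
    (hu : ContDiff ℝ ∞ u) (x : ℝ³) : DifferentiableAt ℝ u x :=
  hu.differentiable (by simp) x

/-! ### `L^p` bookkeeping -/

section Lp

variable {p : ℝ≥0∞}

/-- Auxiliary (theorem `aestronglyMeasurable_of_contDiff`): aestronglyMeasurable of contDiff. [folklore] -/
theorem aestronglyMeasurable_of_contDiff {F : Type*} [NormedAddCommGroup F] [NormedSpace ℝ F]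
    {u : ℝ³ → F} (hu : ContDiff ℝ ∞ u) :
    AEStronglyMeasurable (fun x => ‖fderiv ℝ u x‖) volume :=
  (hu.continuous_fderiv (by simp)).norm.aestronglyMeasurable

/-- **The `L^p` bound for `Dw₀`**: `‖Dw₀‖_p ≤ 9 C_p ‖f‖_p`, `C_p` the constant of the tree's
Calderón–Zygmund bound for the Hessian of the truncated Newtonian potential. [folklore] -/
theorem eLpNorm_fderiv_gradPotential_le (hp : 1 < p) (hp' : p < ⊤) :
    ∃ C : ℝ≥0, ∀ ⦃δ : ℝ⦄, 0 < δ → ∀ ⦃f : ℝ³ → ℝ⦄, ContDiff ℝ ∞ f → HasCompactSupport f →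
      eLpNorm (fun x => ‖fderiv ℝ (gradPotential δ f) x‖) p volume ≤ (9 * C : ℝ≥0) * eLpNorm f p volume := by
  obtain ⟨C, hC⟩ := stein1970_hessian_Lp_bound_holds_fin3.hessian_newtonNearPotential_half hp hp'
  refine ⟨C, fun δ hδ f hf hfc => ?_⟩
  set N := newtonNearPotential (δ / 2) δ f with hN
  have hij : ∀ i j, eLpNorm (fun x => fderiv ℝ (fun y => fderiv ℝ N y (e i)) x (e j)) p volume ≤
      C * eLpNorm f p volume := fun i j =>
    hC hδ (hf.of_le two_le_infty) hfc (e i) (e j) (by rw [norm_e]) (by rw [norm_e])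
  have hcont : ∀ i j, Continuous (fun x => |fderiv ℝ (fun y => fderiv ℝ N y (e i)) x (e j)|) := fun i j => by
    have hc : ContDiff ℝ ∞ (fun y => fderiv ℝ N y (e i)) := contDiff_fderiv_apply_e hδ hf i
    exact ((hc.continuous_fderiv (by simp)).clm_apply continuous_const).abs
  have hmeas : ∀ i j, AEStronglyMeasurable
      (fun x => |fderiv ℝ (fun y => fderiv ℝ N y (e i)) x (e j)|) volume := fun i j =>
    (hcont i j).aestronglyMeasurable
  calc eLpNorm (fun x => ‖fderiv ℝ (gradPotential δ f) x‖) p volume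
      ≤ eLpNorm (fun x => ∑ i, ∑ j, |fderiv ℝ (fun y => fderiv ℝ N y (e i)) x (e j)|) p volume := by
        refine eLpNorm_mono fun x => ?_
        rw [Real.norm_eq_abs, abs_norm, Real.norm_eq_abs, abs_of_nonneg
          (Finset.sum_nonneg fun i _ => Finset.sum_nonneg fun j _ => abs_nonneg _)]
        exact norm_fderiv_gradPotential_le hδ hf x
    _ ≤ ∑ i, eLpNorm (fun x => ∑ j, |fderiv ℝ (fun y => fderiv ℝ N y (e i)) x (e j)|) p volume := by
        have := eLpNorm_sum_le (s := Finset.univ) (μ := (volume : Measure ℝ³)) (p := p)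
          (f := fun i x => ∑ j, |fderiv ℝ (fun y => fderiv ℝ N y (e i)) x (e j)|)
          (fun i _ => (continuous_finsetSum _ fun j _ => hcont i j).aestronglyMeasurable) hp.le
        rwa [Finset.sum_fn] at this
    _ ≤ ∑ i, ∑ j, eLpNorm (fun x => |fderiv ℝ (fun y => fderiv ℝ N y (e i)) x (e j)|) p volume := by
        refine Finset.sum_le_sum fun i _ => ?_
        have := eLpNorm_sum_le (s := Finset.univ) (μ := (volume : Measure ℝ³)) (p := p)
          (f := fun j x => |fderiv ℝ (fun y => fderiv ℝ N y (e i)) x (e j)|)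
          (fun j _ => hmeas i j) hp.le
        rwa [Finset.sum_fn] at this
    _ ≤ ∑ _i : Fin 3, ∑ _j : Fin 3, (C : ℝ≥0∞) * eLpNorm f p volume := by
        refine Finset.sum_le_sum fun i _ => Finset.sum_le_sum fun j _ => ?_
        have e1 : (fun x => |fderiv ℝ (fun y => fderiv ℝ N y (e i)) x (e j)|) =
            fun x => ‖fderiv ℝ (fun y => fderiv ℝ N y (e i)) x (e j)‖ := rfl
        rw [e1, eLpNorm_norm]
        exact hij i j
    _ = (9 * C : ℝ≥0) * eLpNorm f p volume := by
        simp only [Finset.sum_const, Finset.card_univ, Fintype.card_fin, nsmul_eq_mul]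
        push_cast
        ring

end Lp

/-! ### The corrector `w = w₀ + W[Λ f]` -/

/-- **The ring corrector** `w = ∇N_{δ/2,δ}[f] + W_{a,b}[Λ_{δ/2,δ} f]`: a compactly supported
solution of `div w = f` on the cubical shell `S(a, b)` for `f` supported in `S(a + δ, b − δ)` with
`∫ f = 0` — the tree's substitute for Bogovskiĭ's operator in Seregin–Wang 2020, Prop. 2.1.
[folklore] -/
def ringCorrector (a b δ : ℝ) (f : ℝ³ → ℝ) (x : ℝ³) : ℝ³ :=
  gradPotential δ f x + W a b (newtonFarSmoothing (δ / 2) δ f) x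

/-- The hypotheses of the ring corrector. [folklore] -/
structure Geometry (a b δ : ℝ) (f : ℝ³ → ℝ) : Prop where
  /-- Field `ha`. -/
  ha : 0 < a
  /-- Field `hδ`. -/
  hδ : 0 < δ
  /-- Field `hring`. -/
  hring : a + δ < b - δ
  /-- Field `hb2`. -/
  hb2 : b ≤ 2 * a
  /-- Field `smooth`. -/
  smooth : ContDiff ℝ ∞ f
  /-- Field `vanish`. -/
  vanish : ∀ x, x ∉ shell (a + δ) (b - δ) → f x = 0
  /-- Field `integral_zero`. -/
  integral_zero : ∫ x, f x = 0

/-- Linearity of the divergence at a point. [folklore] -/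
theorem divergence_add {u v : ℝ³ → ℝ³} {x : ℝ³} (hu : DifferentiableAt ℝ u x)
    (hv : DifferentiableAt ℝ v x) :
    VectorCalculus.divergence (fun y => u y + v y) x =
      VectorCalculus.divergence u x + VectorCalculus.divergence v x := by
  simp only [VectorCalculus.divergence, fderiv_fun_add hu hv, ContinuousLinearMap.toLinearMap_add, map_add]

namespace Geometry

variable (G : Geometry a b δ f)
include G

/-- Auxiliary (theorem `hab`): hab. [folklore] -/
theorem hab : a < b := by linarith [G.hring, G.hδ]
/-- Auxiliary (theorem `hb`): hb. [folklore] -/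
theorem hb : 0 < b := G.ha.trans G.hab
/-- Auxiliary (theorem `hδb`): hδb. [folklore] -/
theorem hδb : δ ≤ b := by linarith [G.hring, G.ha, G.hδ]
/-- Auxiliary (theorem `hℓ`): hℓ. [folklore] -/
theorem hℓ : 0 < b - a := sub_pos.2 G.hab

/-- Auxiliary (theorem `hfc`): hfc. [folklore] -/
theorem hfc : HasCompactSupport f := hasCompactSupport_of_vanish_shell G.vanish

/-- Auxiliary (theorem `integrable`): integrable. [folklore] -/
theorem integrable : Integrable f := G.smooth.continuous.integrable_of_hasCompactSupport G.hfc

/-- The remainder `g₁ = Λ[f]` is a `Datum` on `S(a, b)`. [folklore] -/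
theorem datum : Datum a b (newtonFarSmoothing (δ / 2) δ f) where
  ha := G.ha
  hab := G.hab
  smooth := contDiff_newtonFarSmoothing_top G.hδ G.smooth
  vanish _ hx := image_eq_zero_of_notMem_tsupport fun h =>
    hx (tsupport_newtonFarSmoothing_subset G.hδ G.vanish h)
  integral_zero := integral_newtonFarSmoothing_eq_zero G.hδ G.smooth.continuous G.hfc G.integral_zero

/-- The remainder `g₁ = Λ[f]` satisfies the `BData` bounds with `G₀ = M δ⁻³ I`, `G₁ = 3M δ⁻⁴ I`.
[folklore] -/
theorem bdata : BData a b (newtonFarSmoothing (δ / 2) δ f) (Mker / δ ^ 3 * ∫ y, |f y|)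
    (3 * (Mker / δ ^ 4 * ∫ y, |f y|)) where
  ha := G.ha
  hab := G.hab
  hb2 := G.hb2
  smooth := contDiff_newtonFarSmoothing_top G.hδ G.smooth
  bound₀ := abs_newtonFarSmoothing_le G.hδ G.smooth.continuous G.hfc
  bound₁ := norm_fderiv_newtonFarSmoothing_le G.hδ (G.smooth.of_le (by simp)) G.hfc

/-- The corrector is smooth. [folklore] -/
theorem contDiff_ringCorrector : ContDiff ℝ ∞ (ringCorrector a b δ f) :=
  (contDiff_gradPotential G.hδ G.smooth).add (W_contDiff G.datum.smooth)

/-- The corrector is supported in `S(a, b)`. [folklore] -/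
theorem ringCorrector_eq_zero {x : ℝ³} (hx : x ∉ shell a b) : ringCorrector a b δ f x = 0 := by
  rw [ringCorrector, G.datum.W_eq_zero hx, add_zero]
  exact image_eq_zero_of_notMem_tsupport fun h' => hx (tsupport_gradPotential_subset G.hδ G.vanish h')

/-- Auxiliary (theorem `tsupport_ringCorrector_subset`): tsupport ringCorrector subset. [folklore] -/
theorem tsupport_ringCorrector_subset : tsupport (ringCorrector a b δ f) ⊆ shell a b :=
  closure_minimal (fun x hx => by by_contra h; exact hx (G.ringCorrector_eq_zero h)) (isClosed_shell a b)

/-- Auxiliary (theorem `hasCompactSupport_ringCorrector`): hasCompactSupport ringCorrector. [folklore] -/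
theorem hasCompactSupport_ringCorrector : HasCompactSupport (ringCorrector a b δ f) :=
  (isCompact_shell a b).of_isClosed_subset isClosed_closure G.tsupport_ringCorrector_subset

omit G in
/-- **`div w = f`.** [folklore] -/
theorem divergence_ringCorrector (G : Geometry a b δ f) (x : ℝ³) :
    VectorCalculus.divergence (ringCorrector a b δ f) x = f x := by
  rw [show ringCorrector a b δ f = fun y => gradPotential δ f y + W a b (newtonFarSmoothing (δ / 2) δ f) y
    from rfl, divergence_add (dAt' (contDiff_gradPotential G.hδ G.smooth) x)
      (dAt' (W_contDiff G.datum.smooth) x),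
    divergence_gradPotential G.hδ G.smooth, divergence_W G.datum.smooth]
  ring

/-! #### The `L^p` bound -/

/-- The `sup` bound for `DW[g₁]` in terms of `I = ∫|f|`. [folklore] -/
theorem norm_fderiv_W_le' (x : ℝ³) :
    ‖fderiv ℝ (W a b (newtonFarSmoothing (δ / 2) δ f)) x‖ ≤
      KW * Mker * (b / (b - a)) ^ 5 * (1 / δ ^ 3 + 3 * b / δ ^ 4) * ∫ y, |f y| := by
  refine (norm_fderiv_W_le G.datum G.bdata x).trans (le_of_eq ?_)
  ring

/-- Auxiliary (theorem `support_fderiv_W_subset`): support fderiv W subset. [folklore] -/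
theorem support_fderiv_W_subset :
    support (fun x => ‖fderiv ℝ (W a b (newtonFarSmoothing (δ / 2) δ f)) x‖) ⊆ cube b := by
  intro x hx
  by_contra h
  have hx' : x ∉ tsupport (W a b (newtonFarSmoothing (δ / 2) δ f)) := fun h' =>
    h (shell_subset_cube a b (G.datum.tsupport_W_subset h'))
  exact hx (by simp [fderiv_of_notMem_tsupport ℝ hx'])

/-- Auxiliary (theorem `support_f_subset`): support f subset. [folklore] -/
theorem support_f_subset : support f ⊆ cube b := by
  intro x hx
  by_contra h
  refine hx (G.vanish x fun hm => h fun i => ?_)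
  linarith [hm.2 i, G.hδ]

/-- Volume of the cube: `|cube b| ≤ 27 b³ |B₁|`. [folklore] -/
theorem volume_cube_le :
    volume (cube b) ≤ ENNReal.ofReal (27 * b ^ 3 * (volume (ball (0 : ℝ³) 1)).toReal) := by
  have hb := G.hb
  have hfin : volume (ball (0 : ℝ³) 1) ≠ ⊤ := measure_ball_lt_top.ne
  calc volume (cube b) ≤ volume (closedBall (0 : ℝ³) (3 * b)) := measure_mono (cube_subset_closedBall b)
    _ = ENNReal.ofReal ((3 * b) ^ 3) * volume (ball (0 : ℝ³) 1) := by
        rw [Measure.addHaar_closedBall _ _ (by positivity : (0 : ℝ) ≤ 3 * b), finrank_euclideanSpace_fin]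
    _ = ENNReal.ofReal (27 * b ^ 3 * (volume (ball (0 : ℝ³) 1)).toReal) := by
        rw [ENNReal.ofReal_mul (by positivity), ENNReal.ofReal_toReal hfin]; ring_nf

/-- **`ofReal (∫|f|) ≤ ‖f‖_p |cube b|^{1 - 1/p}`** (Hölder on the support). [folklore] -/
theorem ofReal_integral_abs_le {p : ℝ≥0∞} (hp : 1 ≤ p) :
    ENNReal.ofReal (∫ y, |f y|) ≤
      eLpNorm f p volume * (volume (cube b)) ^ (1 - 1 / p.toReal) := by
  have h1 : ENNReal.ofReal (∫ y, |f y|) = eLpNorm f 1 volume := by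
    rw [eLpNorm_one_eq_lintegral_enorm, ← ofReal_integral_norm_eq_lintegral_enorm G.integrable]
    rfl
  rw [h1, ← eLpNorm_restrict_eq_of_support_subset G.support_f_subset,
    ← eLpNorm_restrict_eq_of_support_subset (p := p) G.support_f_subset]
  have := eLpNorm_le_eLpNorm_mul_rpow_measure_univ hp
    (G.smooth.continuous.aestronglyMeasurable (μ := volume.restrict (cube b)))
  rw [Measure.restrict_apply_univ, ENNReal.toReal_one, div_one] at this
  exact this

/-- **`‖DW[g₁]‖_p ≤ 108 |B̄₁| K_W M (b/(b-a))⁵ (b/δ)⁴ ‖f‖_p`.** [folklore] -/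
theorem eLpNorm_fderiv_W_le {p : ℝ≥0∞} (hp : 1 ≤ p) :
    eLpNorm (fun x => ‖fderiv ℝ (W a b (newtonFarSmoothing (δ / 2) δ f)) x‖) p volume ≤
      ENNReal.ofReal (108 * (volume (ball (0 : ℝ³) 1)).toReal * KW * Mker *
        (b / (b - a)) ^ 5 * (b / δ) ^ 4) * eLpNorm f p volume := by
  have hb := G.hb; have hδ := G.hδ; have hℓ := G.hℓ
  set V := volume (cube b) with hV
  set V₁ := (volume (ball (0 : ℝ³) 1)).toReal with hV₁
  set S := KW * Mker * (b / (b - a)) ^ 5 * (1 / δ ^ 3 + 3 * b / δ ^ 4) * ∫ y, |f y| with hS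
  set A := KW * Mker * (b / (b - a)) ^ 5 * (1 / δ ^ 3 + 3 * b / δ ^ 4) with hA
  have hKM : 0 ≤ KW * Mker := mul_nonneg KW_pos.le Mker_pos.le
  have hq : 0 ≤ b / (b - a) := div_nonneg hb.le hℓ.le
  have hA0 : 0 ≤ A := by rw [hA]; positivity
  have hp0 : 0 ≤ 1 / p.toReal := by positivity
  have hp1 : 0 ≤ 1 - 1 / p.toReal := by
    rw [sub_nonneg, div_le_one_iff]
    rcases eq_or_ne p ⊤ with rfl | hne
    · simp
    · left
      exact ⟨ENNReal.toReal_pos (by rintro rfl; simp at hp) hne,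
        by simpa using ENNReal.toReal_mono hne hp⟩
  -- Step 1: sup bound on the restricted measure
  have h1 : eLpNorm (fun x => ‖fderiv ℝ (W a b (newtonFarSmoothing (δ / 2) δ f)) x‖) p volume ≤
      V ^ (1 / p.toReal) * ENNReal.ofReal S := by
    rw [← eLpNorm_restrict_eq_of_support_subset G.support_fderiv_W_subset]
    have := eLpNorm_le_of_ae_bound (μ := volume.restrict (cube b)) (p := p)
      (f := fun x => ‖fderiv ℝ (W a b (newtonFarSmoothing (δ / 2) δ f)) x‖) (C := S)
      (Eventually.of_forall fun x => by rw [norm_norm]; exact G.norm_fderiv_W_le' x)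
    rwa [Measure.restrict_apply_univ, ← one_div] at this
  -- Step 2: `ofReal S ≤ ofReal A * ‖f‖_p * V^{1-1/p}`
  have h2 : ENNReal.ofReal S ≤ ENNReal.ofReal A * (eLpNorm f p volume * V ^ (1 - 1 / p.toReal)) := by
    rw [hS, show KW * Mker * (b / (b - a)) ^ 5 * (1 / δ ^ 3 + 3 * b / δ ^ 4) * ∫ y, |f y| =
      A * ∫ y, |f y| by rw [hA], ENNReal.ofReal_mul hA0]
    exact mul_le_mul' le_rfl (G.ofReal_integral_abs_le hp)
  -- Step 3: combine, `V^{1/p} V^{1-1/p} = V ≤ 27 b³ V₁`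
  have h3 : V ^ (1 / p.toReal) * (ENNReal.ofReal A * (eLpNorm f p volume * V ^ (1 - 1 / p.toReal))) =
      ENNReal.ofReal A * V * eLpNorm f p volume := by
    have hV1 : V ^ (1 / p.toReal) * V ^ (1 - 1 / p.toReal) = V := by
      rw [← ENNReal.rpow_add_of_nonneg _ _ hp0 hp1, add_sub_cancel, ENNReal.rpow_one]
    calc _ = ENNReal.ofReal A * (V ^ (1 / p.toReal) * V ^ (1 - 1 / p.toReal)) * eLpNorm f p volume := by ring
      _ = _ := by rw [hV1]
  have h4 : ENNReal.ofReal A * V ≤ ENNReal.ofReal (A * (27 * b ^ 3 * V₁)) := by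
    rw [ENNReal.ofReal_mul hA0]
    exact mul_le_mul' le_rfl G.volume_cube_le
  have h5 : A * (27 * b ^ 3 * V₁) ≤ 108 * V₁ * KW * Mker * (b / (b - a)) ^ 5 * (b / δ) ^ 4 := by
    have hV₁ : 0 ≤ V₁ := ENNReal.toReal_nonneg
    have hbδ : 1 ≤ b / δ := by rw [le_div_iff₀ hδ, one_mul]; exact G.hδb
    have e : A * (27 * b ^ 3 * V₁) =
        27 * V₁ * KW * Mker * (b / (b - a)) ^ 5 * ((b / δ) ^ 3 + 3 * (b / δ) ^ 4) := by
      rw [hA]; field_simp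
    rw [e]
    have h6 : (b / δ) ^ 3 + 3 * (b / δ) ^ 4 ≤ 4 * (b / δ) ^ 4 := by
      nlinarith [pow_le_pow_right₀ hbδ (show 3 ≤ 4 by norm_num), pow_nonneg (zero_le_one.trans hbδ) 3]
    have h7 : 0 ≤ 27 * V₁ * KW * Mker * (b / (b - a)) ^ 5 := by
      have := KW_pos; have := Mker_pos; positivity
    nlinarith
  calc _ ≤ V ^ (1 / p.toReal) * ENNReal.ofReal S := h1
    _ ≤ V ^ (1 / p.toReal) * (ENNReal.ofReal A * (eLpNorm f p volume * V ^ (1 - 1 / p.toReal))) :=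
        mul_le_mul' le_rfl h2
    _ = ENNReal.ofReal A * V * eLpNorm f p volume := h3
    _ ≤ ENNReal.ofReal (A * (27 * b ^ 3 * V₁)) * eLpNorm f p volume := mul_le_mul' h4 le_rfl
    _ ≤ _ := mul_le_mul' (ENNReal.ofReal_le_ofReal h5) le_rfl

end Geometry

/-- **The `L^p` bound for the derivative of the ring corrector.** For `1 < p < ∞` there is
`K = K(p) > 0` such that, for every admissible `(a, b, δ, f)`,
`‖D(ringCorrector a b δ f)‖_{L^p} ≤ K (b/(b-a))⁵ (b/δ)⁴ ‖f‖_{L^p}` — the scale-invariant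
first-order estimate which replaces Bogovskiĭ's `‖∇w‖_{L^s} ≤ C(s) ‖u·∇φ‖_{L^s}` of the printed
proof (Seregin–Wang 2020, proof of Prop. 2.1, display after "by Theorem III 3.4 in [Galdi]"),
up to harmless powers of the aspect ratios. [folklore] -/
theorem exists_eLpNorm_fderiv_ringCorrector_le {p : ℝ≥0∞} (hp : 1 < p) (hp' : p < ⊤) :
    ∃ K : ℝ, 0 < K ∧ ∀ (a b δ : ℝ) (f : ℝ³ → ℝ), Geometry a b δ f →
      eLpNorm (fun x => ‖fderiv ℝ (ringCorrector a b δ f) x‖) p volume ≤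
        ENNReal.ofReal (K * (b / (b - a)) ^ 5 * (b / δ) ^ 4) * eLpNorm f p volume := by
  obtain ⟨C, hC⟩ := eLpNorm_fderiv_gradPotential_le hp hp'
  set V₁ := (volume (ball (0 : ℝ³) 1)).toReal with hV₁
  have hV₁ : 0 ≤ V₁ := ENNReal.toReal_nonneg
  refine ⟨9 * C + 108 * V₁ * KW * Mker + 1, by have := KW_pos; have := Mker_pos; positivity, ?_⟩
  intro a b δ f G
  have hb := G.hb; have hδ := G.hδ; have hℓ := G.hℓ
  have hq1 : 1 ≤ b / (b - a) := by rw [le_div_iff₀ hℓ, one_mul]; linarith [G.ha]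
  have hbδ : 1 ≤ b / δ := by rw [le_div_iff₀ hδ, one_mul]; exact G.hδb
  set w₀ := gradPotential δ f with hw₀
  set w₂ := W a b (newtonFarSmoothing (δ / 2) δ f) with hw₂
  have hd₀ : ContDiff ℝ ∞ w₀ := contDiff_gradPotential G.hδ G.smooth
  have hd₂ : ContDiff ℝ ∞ w₂ := W_contDiff G.datum.smooth
  -- pointwise triangle inequality
  have hpt : ∀ x, ‖fderiv ℝ (ringCorrector a b δ f) x‖ ≤ ‖fderiv ℝ w₀ x‖ + ‖fderiv ℝ w₂ x‖ := by
    intro x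
    rw [show ringCorrector a b δ f = fun y => w₀ y + w₂ y from rfl,
      fderiv_fun_add (dAt' hd₀ x) (dAt' hd₂ x)]
    exact norm_add_le _ _
  have hm₀ := aestronglyMeasurable_of_contDiff hd₀
  have hm₂ := aestronglyMeasurable_of_contDiff hd₂
  have T₁ := hC G.hδ G.smooth G.hfc
  have e9 : ((9 * C : ℝ≥0) : ℝ≥0∞) = ENNReal.ofReal (9 * (C : ℝ)) := by
    rw [← ENNReal.ofReal_coe_nnreal]; push_cast; rfl
  rw [e9] at T₁
  have T₂ := G.eLpNorm_fderiv_W_le hp.le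
  have hK : 0 ≤ 108 * V₁ * KW * Mker := by have := KW_pos; have := Mker_pos; positivity
  calc eLpNorm (fun x => ‖fderiv ℝ (ringCorrector a b δ f) x‖) p volume
      ≤ eLpNorm (fun x => ‖fderiv ℝ w₀ x‖ + ‖fderiv ℝ w₂ x‖) p volume := by
        refine eLpNorm_mono fun x => ?_
        rw [Real.norm_eq_abs, abs_norm, Real.norm_eq_abs, abs_of_nonneg (by positivity)]
        exact hpt x
    _ ≤ eLpNorm (fun x => ‖fderiv ℝ w₀ x‖) p volume + eLpNorm (fun x => ‖fderiv ℝ w₂ x‖) p volume :=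
        eLpNorm_add_le hm₀ hm₂ hp.le
    _ ≤ ENNReal.ofReal (9 * (C : ℝ)) * eLpNorm f p volume +
        ENNReal.ofReal (108 * V₁ * KW * Mker * (b / (b - a)) ^ 5 * (b / δ) ^ 4) * eLpNorm f p volume :=
        add_le_add T₁ T₂
    _ = ENNReal.ofReal (9 * C + 108 * V₁ * KW * Mker * (b / (b - a)) ^ 5 * (b / δ) ^ 4) *
        eLpNorm f p volume := by
        rw [← add_mul, ← ENNReal.ofReal_add (by positivity) (by positivity)]
    _ ≤ _ := by
        refine mul_le_mul' (ENNReal.ofReal_le_ofReal ?_) le_rfl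
        have hpow : 1 ≤ (b / (b - a)) ^ 5 * (b / δ) ^ 4 :=
          one_le_mul_of_one_le_of_one_le (one_le_pow₀ hq1) (one_le_pow₀ hbδ)
        nlinarith [C.coe_nonneg, mul_nonneg hK (zero_le_one.trans hpow)]

end RingCorrector

end Literature.Analysis.FluidPDE

end
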